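import Summits.BirchSwinnertonDyer.Rank1Residual.X2.IsogenyMultiplierUnit
import Summits.BirchSwinnertonDyer.Rank1Residual.X2.IsogenyKernelRealPoints
import Summits.BirchSwinnertonDyer.Rank1Residual.X2.UnramifiedLineIntegral
import Summits.BirchSwinnertonDyer.Rank1Residual.X2.IsogenyQuotientLine
import Literature.NumberTheory.EllipticCurves.IsogenyQuotientCurveProofs
import Literature.NumberTheory.EllipticCurves.IsogenyVariableChangeProofs
import Literature.NumberTheory.EllipticCurves.IsogenyCompProofs
import Literature.NumberTheory.EllipticCurves.PlaceOverInertiaOrbitProofs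
import Literature.NumberTheory.EllipticCurves.KummerSelmerStructure
import Literature.NumberTheory.EllipticCurves.BSDSelmerCMPConverseMaximalOrderProofs
import Literature.NumberTheory.EllipticCurves.PadicSigmaUniquenessOrdinaryProofs
import HarnessLib

/-!
# The period clause of Greenberg–Vatsal Cor. (3.8), derived: the quotient by an unramified odd
# rational `p`-line changes the real period by a `p`-adic unit (cell `b2b-bsdres`, unit
# `b2b-bsdres-eisenstein-p2`, gen 28)

HONEST FRAMING (run/shared/lean/b2b/bsd-rank1-residual/, verbatim in every file): the goal of the
cell is to DELETE the COMBINATION-SHAPED residual classes of the Birch–Swinnerton-Dyer formula for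
ALL analytic-rank `≤ 1` elliptic curves over `ℚ` — "full BSD formula for every rank `≤ 1` curve in
class `C`" assembled STRICTLY from published theorems — so that the rank-`≤ 1` remainder becomes
exactly the CONSTRUCTION-SHAPED classes, which are TYPED (missing-input `Prop`s), NOT attempted.
This is not "finishing BSD". Research route; NO CLAIM BEYOND STATED CLASSES; nothing here changes
a label. Theorems only; no definition, no named fact.

WHAT. Registered fact A180 (`GreenbergVatsal2000.cor38_realPeriodRat_eq_unit_mul_of_isIsogenous_of_gvPar`,
the binder `hP` of the X2a closure term `targetA_of_derivedTrivialZero_heightFree`) in the form its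
one consumer (`X2.GreenbergVatsalCaseTwo.caseTwo_clause_of_inputs`) uses, PROVED in the kernel:

* **`exists_quot_realPeriodRat_eq_unit_mul`** — for a globally minimal `E/ℚ`, an odd prime `p` at
  which `E` is good ordinary or multiplicative, and a rational `p`-line `Φ₀ ≤ E[p]` that is
  UNRAMIFIED and ODD at `p`, there are a globally minimal `E'`, a `ℚ`-isogeny `g : E → E'` with
  `ker g = Φ₀` and `deg g = p`, and `u ∈ ℚ` with `|u|_p = 1` and `Ω(E') = u · Ω(E)`;
  `…_of_mult` is the multiplicative reading.

PROOF (elementary; no Néron models, no Tate curves). `E' := C • (E/Φ₀)` (the tree's quotient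
curve `quotCurve` and a global minimal model `C`), `g :=` change of variables `∘ quotIsogeny`, so
`x(gP) = u_C⁻²(c₀ Σ_{s ∈ Φ₀} x(P+s) − r_C)` off `Φ₀` (`xy_quotFun`, `toIsogeny_some`).  The analytic
side (`X2.IsogenyKernelRealPoints.exists_multiplier_of_lineOdd`, from ODD): `Ω(E') = |k| Ω(E)` with
`x(gP) = A(x)/B(x)`, `lc A = k⁻²`, `k = n ∈ ℤ`.  The `p`-adic side
(`X2.IsogenyMultiplierUnit.not_le_val_leadingCoeff_of_ne_zero`, from UNRAMIFIED via
`X2.UnramifiedLineIntegral`: the points of `Φ₀` are `𝔓`-integral, and from `A_p ≠ 0` for `E, E'`):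
`p ∤ n`.  Hence `u := |n|`.  Printed counterpart: T. & V. Dokchitser, *Local invariants of
isogenous elliptic curves*, Trans. AMS 367 (2015), Props. 16, 18 and Thm. 2.

References: [DokchitserLocalInvariants2015] Props. 16, 18, Thm. 2; [GreenbergVatsal2000] §3
Cor. (3.8) p. 40; [SilvermanAEC2009] III.4.12, VII.2; HOME/b2b-bsdres-eisenstein-p2/X2-GAP.md §33.
-/

set_option autoImplicit false

noncomputable section

open scoped Classical NNReal NumberField

open WeierstrassCurve Polynomial IsDedekindDomain NumberField Field
  Literature.NumberTheory.EllipticCurves Literature.NumberTheory.EllipticCurves.FormalGroupChart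
  Literature.NumberTheory.EllipticCurves.Rank1Residual WeierstrassCurve.geomPoints
  Literature.NumberTheory.GaloisRepresentations Rat.HeightOneSpectrum

namespace Summit.BirchSwinnertonDyer.Rank1Residual.X2.IsogenyPeriodRatio

/-! ## §1. Two transports -/

/-- Over `ℚ̄`, a globally minimal `W/ℚ` is the base change of its integral model `W_ℤ`.
[folklore] -/
theorem baseChange_algClosure_eq_map_integralModelInt (W : WeierstrassCurve ℚ) [W.IsGloballyMinimal] :
    W.baseChange (AlgebraicClosure ℚ) =
      (integralModelInt W).map (Int.castRingHom (AlgebraicClosure ℚ)) := by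
  conv_lhs => rw [← map_integralModelInt W]
  rw [baseChange, WeierstrassCurve.map_map]
  congr 1

/-- **An `ℝ≥0`-valued valuation of `ℚ̄` defining the place `placeOver p`**: the pull-back of the
spectral valuation of `\bar ℚ_p` along an embedding adapted to the prime of the place
(`PlaceOverInertiaOrbitProofs`: `mem_placeOver_iff_spectralValuation_le_one` and its two
corollaries). [cite: SerreLocalFields1979, Ch. I §7 Prop. 19–21] -/
theorem exists_valuation_placeOver (p : ℕ) [Fact p.Prime] :
    ∃ w : Valuation (AlgebraicClosure ℚ) ℝ≥0,
      (∀ z, z ∈ placeOver p ↔ w z ≤ 1) ∧ (∀ z, (placeOver p).valuation z < 1 ↔ w z < 1) ∧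
        (∀ z, (placeOver p).valuation z = 1 ↔ w z = 1) := by
  have hp : p.Prime := Fact.out
  obtain ⟨v, hv⟩ : ∃ v : HeightOneSpectrum (𝓞 ℚ), (Rat.HeightOneSpectrum.primesEquiv v : ℕ) = p :=
    ⟨(Rat.HeightOneSpectrum.primesEquiv (R := 𝓞 ℚ)).symm ⟨p, hp⟩, by rw [Equiv.apply_symm_apply]⟩
  obtain ⟨𝔓, hmem, h𝔓v⟩ := exists_ideal_placeOver p hv
  obtain ⟨𝔐, h𝔐⟩ := v.localPrimesAbove_nonempty
  obtain ⟨ι, hι⟩ := InertiaTame.exists_primeBelow_eq v h𝔓v h𝔐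
  obtain ⟨w, hw⟩ := v.exists_spectralValuation
  refine ⟨w.comap ι.toRingHom, fun z ↦ ?_, fun z ↦ ?_, fun z ↦ ?_⟩
  · exact mem_placeOver_iff_spectralValuation_le_one p hw h𝔐 ι hmem hι z
  · exact valuation_placeOver_lt_one_iff_spectralValuation_lt_one p hw h𝔐 ι hmem hι z
  · exact valuation_placeOver_eq_one_iff_spectralValuation_eq_one p hw h𝔐 ι hmem hι z

/-! ## §2. The theorem -/

variable {W : WeierstrassCurve ℚ} [W.IsElliptic] [W.IsGloballyMinimal] {p : ℕ} [hp : Fact p.Prime]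

/-- **The quotient by an unramified odd rational `p`-line changes the real period by a `p`-adic
unit** (Greenberg–Vatsal Cor. (3.8), period clause, derived; Dokchitser–Dokchitser 2015 Props.
16/18 with Thm. 2).  Hypotheses: `p` odd; the Hasse invariant of `W_ℤ mod p` is non-zero and stays
so along `ℚ`-isogenies from `W` to globally minimal curves (`hA`, `hA'`: good ordinary or
multiplicative reduction, see `…_of_goodOrd_or_mult`); `Φ₀` a rational `p`-line, unramified and odd
at `p`. [cite: DokchitserLocalInvariants2015, Prop. 16, Prop. 18 and Thm. 2]
[cite: GreenbergVatsal2000, §3 Cor. (3.8) p. 40] -/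
theorem exists_quot_realPeriodRat_eq_unit_mul_of_hasse (hp2 : p ≠ 2)
    (hA : ((integralModelInt W).map (Int.castRingHom (ZMod p))).hasseCoeff p ≠ 0)
    (hA' : ∀ (W' : WeierstrassCurve ℚ) [W'.IsElliptic] [W'.IsGloballyMinimal], IsIsogenous W W' →
      ((integralModelInt W').map (Int.castRingHom (ZMod p))).hasseCoeff p ≠ 0)
    {Φ₀ : AddSubgroup (geomTorsion W (p : ℤ))} (hΦ : IsRationalLine W p Φ₀)
    (hunr : LineUnramifiedAt W p Φ₀) (hodd : LineOdd W p Φ₀) :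
    ∃ (W' : WeierstrassCurve ℚ) (_ : W'.IsElliptic) (_ : W'.IsGloballyMinimal) (g : Isogeny W W'),
      g.toAddMonoidHom.ker = Φ₀.map (geomTorsion W (p : ℤ)).subtype ∧ g.degree = p ∧
        ∃ u : ℚ, ‖(u : ℚ_[p])‖ = 1 ∧ W'.realPeriodRat = (u : ℝ) * W.realPeriodRat := by
  have hpP : p.Prime := hp.out
  -- the subgroup `S = Φ₀ ≤ E(ℚ̄)`
  set S : AddSubgroup W.geomPoints := Φ₀.map (geomTorsion W (p : ℤ)).subtype with hS
  have hScard : Nat.card S = p := IsogenyQuotientLine.natCard_map_subtype hΦ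
  have hSfin : (S : Set W.geomPoints).Finite := by
    have : Finite S := Nat.finite_of_card_ne_zero (by rw [hScard]; exact hpP.ne_zero)
    exact Set.toFinite _
  have hSstab : ∀ (σ : absoluteGaloisGroup ℚ) (P : W.geomPoints), P ∈ S → σ • P ∈ S := by
    rintro σ _ ⟨P, hP, rfl⟩
    exact ⟨σ • P, hΦ.2 σ P hP, rfl⟩
  -- the quotient curve, its global minimal model, the isogeny
  set Q : WeierstrassCurve ℚ := W.quotCurve S hSfin hSstab with hQ
  obtain ⟨C, hC⟩ := hasGlobalMinimalModel_rat_holds Q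
  haveI := hC
  set g : Isogeny W (C • Q) := (VariableChange.toIsogeny Q C).comp (W.quotIsogeny S hSfin hSstab)
    with hg
  have hker : g.toAddMonoidHom.ker = S := by
    rw [hg, Isogeny.ker_comp, VariableChange.ker_toIsogeny, AddMonoidHom.comap_bot, ker_quotIsogeny]
  have hdeg : g.degree = p := by
    unfold Isogeny.degree; rw [hker, hScard]
  -- the analytic multiplier
  obtain ⟨k, hk0, hΩ, ⟨A, B, hBm, hdegAB, hlc, hform⟩, hint⟩ :=
    IsogenyKernelRealPoints.exists_multiplier_of_lineOdd hp2 g hΦ hker hodd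
  obtain ⟨n, hn⟩ := hint inferInstance hC
  have hn0 : n ≠ 0 := by rintro rfl; exact hk0 (by rw [← hn, Int.cast_zero])
  -- the conclusion from `p ∤ n`
  suffices hpn : ¬ (p : ℤ) ∣ n by
    refine ⟨C • Q, inferInstance, hC, g, hker, hdeg, (n.natAbs : ℚ), ?_, ?_⟩
    · have h1 : ((n.natAbs : ℚ) : ℚ_[p]) = ((n.natAbs : ℤ) : ℚ_[p]) := by
        rw [Rat.cast_natCast, Int.cast_natCast]
      rw [h1]
      refine le_antisymm (Padic.norm_int_le_one _) (not_lt.mp fun hlt ↦ hpn ?_)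
      have := Padic.norm_intCast_lt_one_iff.mp hlt
      exact Int.dvd_natAbs.mp this
    · rw [hΩ, ← hn, Rat.cast_natCast, Rat.cast_intCast, Nat.cast_natAbs, Int.cast_abs]
  intro hpn
  -- an adapted `ℝ≥0`-valuation of `ℚ̄`
  obtain ⟨w, hle1, hlt1, heq1⟩ := exists_valuation_placeOver p
  have hint' : ∀ m : ℤ, w (m : AlgebraicClosure ℚ) ≤ 1 := fun m ↦
    (hle1 _).mp (intCast_mem (placeOver p) m)
  have hunit' : ∀ m : ℤ, ¬ (p : ℤ) ∣ m → w (m : AlgebraicClosure ℚ) = 1 := fun m hm ↦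
    (heq1 _).mp (valuation_placeOver_intCast_eq_one p hm)
  have hpw : w (p : AlgebraicClosure ℚ) < 1 := (hlt1 _).mp (valuation_placeOver_natCast_lt_one p)
  have h2 : w (2 : AlgebraicClosure ℚ) = 1 := by
    have hp2' : ¬ (p : ℤ) ∣ 2 := fun h ↦ hp2 (by
      have h1 := Int.le_of_dvd (by norm_num) h
      have h2 := hpP.two_le
      omega)
    exact_mod_cast hunit' 2 hp2'
  -- integrality of the two equations over `(ℚ̄, w)`
  have heqW := baseChange_algClosure_eq_map_integralModelInt W
  have heqQ := baseChange_algClosure_eq_map_integralModelInt (C • Q)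
  haveI hintW : (W.baseChange (AlgebraicClosure ℚ)).IsIntegral w.integer := by
    rw [heqW]
    refine isIntegral_integer_of_val_le_one ?_ ?_ ?_ ?_ ?_ <;>
      simp only [map_a₁, map_a₂, map_a₃, map_a₄, map_a₆, eq_intCast] <;> exact hint' _
  haveI hintQ : ((C • Q).baseChange (AlgebraicClosure ℚ)).IsIntegral w.integer := by
    rw [heqQ]
    refine isIntegral_integer_of_val_le_one ?_ ?_ ?_ ?_ ?_ <;>
      simp only [map_a₁, map_a₂, map_a₃, map_a₄, map_a₆, eq_intCast] <;> exact hint' _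
  -- the height-one shapes of the `p`-division polynomials
  obtain ⟨-, hdW, -⟩ := valuation_coeff_preΨ'_of_hasseCoeff_ne_zero (w := w)
    (L := AlgebraicClosure ℚ) (integralModelInt W) hp2 hA hint' hunit'
  rw [← heqW] at hdW
  obtain ⟨hcoefQ, hdQ, hhighQ⟩ := valuation_coeff_preΨ'_of_hasseCoeff_ne_zero (w := w)
    (L := AlgebraicClosure ℚ) (integralModelInt (C • Q)) hp2 (hA' (C • Q) ⟨g⟩) hint' hunit'
  rw [← heqQ] at hcoefQ hdQ hhighQ
  -- `S` is killed by `p`, and its non-zero points are `w`-integral (UNRAMIFIED)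
  have hSp : ∀ s ∈ S, (p : ℤ) • s = 0 := by
    rintro _ ⟨P, -, rfl⟩
    exact (mem_geomTorsion_iff _ _ _).mp P.2
  have hSint : ∀ s ∈ S, s ≠ 0 → s ∉ kernel w (W.baseChange (AlgebraicClosure ℚ)) := by
    rintro _ ⟨P, hPΦ, rfl⟩ hs0 hmem
    rcases hP : (P : W.geomPoints) with _ | ⟨x, y, h⟩
    · exact hs0 hP
    · have hx : (placeOver p).valuation x ≤ 1 :=
        UnramifiedLineIntegral.valuation_le_one_of_lineUnramifiedAt hp2 hA hunr hPΦ hP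
      have hx' : w x ≤ 1 := (hle1 x).mp (((placeOver p).valuation_le_one_iff x).mp hx)
      exact (not_lt.mpr hx') (hmem hP)
  -- a point of order `2`
  have hT2 : ∃ T : W.geomPoints, T ≠ 0 ∧ (2 : ℤ) • T = 0 := by
    have hcard : Nat.card (geomTorsion W (2 : ℤ)) = 4 := by
      rw [natCard_geomTorsion W (2 : ℤ) two_ne_zero]; rfl
    haveI : Finite (geomTorsion W (2 : ℤ)) := Nat.finite_of_card_ne_zero (by rw [hcard]; norm_num)
    haveI : Nontrivial (geomTorsion W (2 : ℤ)) :=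
      Finite.one_lt_card_iff_nontrivial.mp (by rw [hcard]; norm_num)
    obtain ⟨T, hT⟩ := exists_ne (0 : geomTorsion W (2 : ℤ))
    refine ⟨(T : W.geomPoints), fun h0 ↦ hT (Subtype.ext h0), (mem_geomTorsion_iff _ _ _).mp T.2⟩
  -- the coordinate description of `g` off `S`
  set Xs : W.geomPoints → AlgebraicClosure ℚ := fun P ↦ ∑ s ∈ hSfin.toFinset, xy (P + s) 0 with hXs
  -- the change of variables over `ℚ̄` (along the `AlgebraicClosure.instAlgebra` structure map, as in
  -- `VariableChange.toIsogeny_some`)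
  set Cb : VariableChange (AlgebraicClosure ℚ) :=
    C.map (@algebraMap ℚ (AlgebraicClosure ℚ) _ _ (AlgebraicClosure.instAlgebra ℚ)) with hCb
  have hcoord : ∀ (x y : AlgebraicClosure ℚ)
      (h : (W.baseChange (AlgebraicClosure ℚ)).toAffine.Nonsingular x y),
      (Affine.Point.some x y h : W.geomPoints) ∉ S →
      ∃ (x' y' : AlgebraicClosure ℚ)
        (h' : ((C • Q).baseChange (AlgebraicClosure ℚ)).toAffine.Nonsingular x' y'),
        g (Affine.Point.some x y h) = (Affine.Point.some x' y' h' : (C • Q).geomPoints) ∧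
          x' = (((Cb.u⁻¹ : (AlgebraicClosure ℚ)ˣ) : AlgebraicClosure ℚ) ^ 2 * W.relCoeff hSfin 0) *
              Xs (Affine.Point.some x y h) +
            (-(((Cb.u⁻¹ : (AlgebraicClosure ℚ)ˣ) : AlgebraicClosure ℚ) ^ 2 * Cb.r)) := by
    intro x y h hPS
    obtain ⟨hq0, hqx, -⟩ := xy_quotFun hSfin hSstab (P := (Affine.Point.some x y h : W.geomPoints)) hPS
    rcases hq : W.quotFun hSfin hSstab (Affine.Point.some x y h : W.geomPoints) with _ | ⟨x₁, y₁, h₁⟩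
    · exact (hq0 hq).elim
    rw [hq, xy_some] at hqx
    simp only [Matrix.cons_val_zero] at hqx
    have hgP : g (Affine.Point.some x y h) =
        VariableChange.toIsogeny Q C (Affine.Point.some x₁ y₁ h₁ : Q.geomPoints) := by
      rw [hg, Isogeny.comp_apply, quotIsogeny_apply, hq]
    rw [VariableChange.toIsogeny_some Q C h₁] at hgP
    have hqx' : x₁ = W.relCoeff hSfin 0 * Xs (Affine.Point.some x y h : W.geomPoints) := hqx
    exact ⟨_, _, _, hgP, by rw [VariableChange.toX_def, hqx']; ring⟩
  -- the rational-function description of `g` off `S`, over `ℚ̄`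
  have hev : ∀ (q : ℚ[X]) (x : AlgebraicClosure ℚ),
      (q.map (algebraMap ℚ (AlgebraicClosure ℚ))).eval x = aeval x q := fun q x ↦ by
    rw [eval_map, aeval_def]
  have hBm' : (B.map (algebraMap ℚ (AlgebraicClosure ℚ))).Monic := hBm.map _
  have hdeg' : (A.map (algebraMap ℚ (AlgebraicClosure ℚ))).natDegree =
      (B.map (algebraMap ℚ (AlgebraicClosure ℚ))).natDegree + 1 := by
    rw [natDegree_map, natDegree_map, hdegAB]
  have hform' : ∀ (x y : AlgebraicClosure ℚ)
      (h : (W.baseChange (AlgebraicClosure ℚ)).toAffine.Nonsingular x y),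
      (Affine.Point.some x y h : W.geomPoints) ∉ S →
      (B.map (algebraMap ℚ (AlgebraicClosure ℚ))).eval x ≠ 0 ∧
        ∃ (y' : AlgebraicClosure ℚ) (h' : ((C • Q).baseChange (AlgebraicClosure ℚ)).toAffine.Nonsingular
          ((A.map (algebraMap ℚ (AlgebraicClosure ℚ))).eval x /
            (B.map (algebraMap ℚ (AlgebraicClosure ℚ))).eval x) y'),
          g (Affine.Point.some x y h) =
            (Affine.Point.some ((A.map (algebraMap ℚ (AlgebraicClosure ℚ))).eval x /
              (B.map (algebraMap ℚ (AlgebraicClosure ℚ))).eval x) y' h' : (C • Q).geomPoints) := by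
    intro x y h hPS
    have hg0 : g (Affine.Point.some x y h) ≠ 0 := fun h0 ↦ hPS (by
      rw [← hker]; exact h0)
    obtain ⟨hB0, y₂, h₂, hgP⟩ := hform x y h hg0
    simp_rw [hev]
    exact ⟨hB0, y₂, h₂, hgP⟩
  -- `|lc A| = |n|⁻² ≥ |p|⁻²` if `p ∣ n`
  have hκ : (w (p : AlgebraicClosure ℚ))⁻¹ ^ 2 ≤
      w (A.map (algebraMap ℚ (AlgebraicClosure ℚ))).leadingCoeff := by
    rw [leadingCoeff_map, hlc, map_pow, map_inv₀, ← hn, map_pow, map_inv₀]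
    have h1 : algebraMap ℚ (AlgebraicClosure ℚ) (n : ℚ) = (n : AlgebraicClosure ℚ) := by
      rw [map_intCast]
    rw [h1]
    have hwn : w (n : AlgebraicClosure ℚ) ≤ w (p : AlgebraicClosure ℚ) := by
      obtain ⟨m, rfl⟩ := hpn
      push_cast
      rw [map_mul]
      exact mul_le_of_le_one_right zero_le (hint' m)
    have hn0' : w (n : AlgebraicClosure ℚ) ≠ 0 :=
      (Valuation.ne_zero_iff w).mpr (by exact_mod_cast hn0)
    exact pow_le_pow_left₀ zero_le ((inv_le_inv₀ (lt_of_lt_of_le (zero_lt_iff.mpr hn0') hwn)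
      (zero_lt_iff.mpr hn0')).mpr hwn) 2
  exact IsogenyMultiplierUnit.not_le_val_leadingCoeff_of_ne_zero
    (V := W.baseChange (AlgebraicClosure ℚ)) (V' := (C • Q).baseChange (AlgebraicClosure ℚ))
    hp2 hpw h2 hdW hcoefQ hdQ hhighQ hSfin hSp hSint hT2 g.toAddMonoidHom (fun P ↦ xy P 0)
    rfl (fun _ _ _ ↦ rfl) hcoord hBm' hdeg' hform' hκ

/-- **The period clause of Greenberg–Vatsal Cor. (3.8), derived** (fact A180, consumer form): at
an odd prime `p` of GOOD ORDINARY or MULTIPLICATIVE reduction, the quotient of a globally minimal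
`E/ℚ` by an unramified odd rational `p`-line has real period `u · Ω(E)` with `|u|_p = 1`.  The
Hasse hypotheses of `…_of_hasse` are discharged by `hasseCoeff_reduction_ne_zero` /
`hasseCoeff_integralModelInt_ne_zero_of_mult` and the `ℚ`-isogeny invariance of the reduction type
and of ordinarity (`IsIsogenous.hasGoodReductionAtPrime_iff`, `….not_dvd_frobeniusTrace_iff`,
`hasMultiplicativeReductionAtPrime_of_isIsogenous`).
[cite: GreenbergVatsal2000, §3 Cor. (3.8) p. 40] [cite: DokchitserLocalInvariants2015, Prop. 16, Prop. 18 and Thm. 2] -/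
theorem exists_quot_realPeriodRat_eq_unit_mul (hp2 : p ≠ 2)
    (hred : (W.HasGoodReductionAtPrime p ∧ ¬ (p : ℤ) ∣ W.frobeniusTrace p) ∨
      W.HasMultiplicativeReductionAtPrime p)
    {Φ₀ : AddSubgroup (geomTorsion W (p : ℤ))} (hΦ : IsRationalLine W p Φ₀)
    (hunr : LineUnramifiedAt W p Φ₀) (hodd : LineOdd W p Φ₀) :
    ∃ (W' : WeierstrassCurve ℚ) (_ : W'.IsElliptic) (_ : W'.IsGloballyMinimal) (g : Isogeny W W'),
      g.toAddMonoidHom.ker = Φ₀.map (geomTorsion W (p : ℤ)).subtype ∧ g.degree = p ∧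
        ∃ u : ℚ, ‖(u : ℚ_[p])‖ = 1 ∧ W'.realPeriodRat = (u : ℝ) * W.realPeriodRat := by
  rcases hred with ⟨hgood, hord⟩ | hmult
  · refine exists_quot_realPeriodRat_eq_unit_mul_of_hasse hp2
      (W.hasseCoeff_reduction_ne_zero p hp2 hgood hord) (fun W' _ _ hiso ↦ ?_) hΦ hunr hodd
    exact W'.hasseCoeff_reduction_ne_zero p hp2 ((hiso.hasGoodReductionAtPrime_iff p).mp hgood)
      ((hiso.not_dvd_frobeniusTrace_iff p hgood).mp hord)
  · refine exists_quot_realPeriodRat_eq_unit_mul_of_hasse hp2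
      (UnramifiedLineIntegral.hasseCoeff_integralModelInt_ne_zero_of_mult hp2 hmult)
      (fun W' _ _ hiso ↦ ?_) hΦ hunr hodd
    exact UnramifiedLineIntegral.hasseCoeff_integralModelInt_ne_zero_of_mult hp2
      (IsogenyQuotientLine.hasMultiplicativeReductionAtPrime_of_isIsogenous hiso hmult)

end Summit.BirchSwinnertonDyer.Rank1Residual.X2.IsogenyPeriodRatio

end
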